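/-
Origin: expansion seat `planner-pub-hodgecm-pv13-0`, handover 2026-08-18 (`HOME/pub-hodgecm-pv13/lean/Pv13/SideFromPieces.lean`, md5 8ea55168, 75 lines);
landed by the gen-6 packager in gate run 22 as `HodgeCM/PerL34/SideFromPieces.lean` (import ^import Pv[0-9]+\.→import HodgeCM.PerL34. ×2).
-/
/-
Origin: pub-hodgecm-pv13 (DAG-NODE PROVER #13) — the carver's seam-S3 constructor `SideOutputs.ofN31Files`
(LEMMAS.md §9, v4) as far as it can be typed tonight: a `CharsAssembly.SideOutputs` for one side from PIECES —
per character two `EulerFactorisation.LocalFactorPieces` (⇒ `LocalFactorDatum`, `rallis` a theorem) and one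
`ConstituentSplit.AllowedBridge` (⇒ `allowed_of_pair` from the kernel `archType_matches`).
Imports `Pv13.ConstituentSplit` + `Pv13.LocalFactorPieces` (→ `HodgeCM.PerL34.*`).  Proposed place:
`HodgeCM/PerL34/SideFromPieces.lean`, namespace `HodgeCM.PerL34.EulerProduct`.  Nothing cited, nothing asserted.
-/
import Summits.HodgeConjecture.HodgeCM.PerL34.ConstituentSplit
import Summits.HodgeConjecture.HodgeCM.PerL34.LocalFactorPieces

set_option autoImplicit false

/-!
# Seam S3: a side of the N31 cluster from pieces

`SideOutputs.ofPieces P₁ P₂ B : SideOutputs D Pl` and `clusterOutputs_of_pieces : … → ClusterOutputs T`.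
After this file the inputs of `h31 : ClusterOutputs T` (carver `perL_of_leaves`) are, per good context and side and
character: the FIELDS of two `LocalFactorPieces` (adelic shell + N31e statement + Petersson identity + restricted-product
`Datum` + local integrands + N31f/N31g local fields) and of one `AllowedBridge` (two `ConstituentDictionary`s — print
(r1)(r2), D2/D5 data, (r2′-an) — and the Def 3.2 clause `allowed_of`).  No opaque `rallis`/`allowed_of_pair`.
-/

noncomputable section

namespace HodgeCM
namespace PerL34
namespace EulerProduct

open HodgeCM.Prior.Perl34File

variable {H HG CG G SK SigIdx SigIdxG : Type*}
variable [NormedAddCommGroup H] [InnerProductSpace ℂ H] [CompleteSpace H]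
variable [NormedAddCommGroup HG] [InnerProductSpace ℂ HG] [CompleteSpace HG]
variable [NormedAddCommGroup CG] [NormedSpace ℂ CG]
variable [Group G] [TopologicalSpace G] [TopologicalSpace SK]
variable {C : Perl34.IsolationCore H HG CG G SK SigIdx SigIdxG}
variable {Pl : Type} [Countable Pl]

/-- **S3 constructor for a side.** -/
def SideOutputs.ofPieces {D : Perl34.TorusData C} (P₁ P₂ : D.X → EulerFactorisation.LocalFactorPieces Pl HG)
    (B : AllowedBridge D (fun χ => (P₁ χ).toLocalFactorDatum) (fun χ => (P₂ χ).toLocalFactorDatum)) :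
    SideOutputs D Pl :=
  B.toSideOutputs

/-- Lemma 4.2(b) for the side, from pieces. -/
theorem allowed_all_of_pieces {D : Perl34.TorusData C} (P₁ P₂ : D.X → EulerFactorisation.LocalFactorPieces Pl HG)
    (B : AllowedBridge D (fun χ => (P₁ χ).toLocalFactorDatum) (fun χ => (P₂ χ).toLocalFactorDatum)) :
    ∀ χ : D.X, D.allowed χ :=
  (SideOutputs.ofPieces P₁ P₂ B).allowed_all

/-- **The pieces of the whole cluster** for the MODEL `T` (both sides in one good context). -/
structure ClusterPieces {U : Universe} (T : U.ThetaModel) {L : CMField} {ι₁ : L →+* ℂ}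
    (V : HermSpace3 L ι₁) (c : SeesawCtx L) (Pl : Type) [Countable Pl] where
  P₁ : (T.t12 V c).X → EulerFactorisation.LocalFactorPieces Pl (T.HG L ι₁ V)
  P₂ : (T.t12 V c).X → EulerFactorisation.LocalFactorPieces Pl (T.HG L ι₁ V)
  B₁₂ : AllowedBridge (T.t12 V c) (fun χ => (P₁ χ).toLocalFactorDatum) (fun χ => (P₂ χ).toLocalFactorDatum)
  P₃ : (T.t34 V c).X → EulerFactorisation.LocalFactorPieces Pl (T.HG L ι₁ V)
  P₄ : (T.t34 V c).X → EulerFactorisation.LocalFactorPieces Pl (T.HG L ι₁ V)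
  B₃₄ : AllowedBridge (T.t34 V c) (fun χ => (P₃ χ).toLocalFactorDatum) (fun χ => (P₄ χ).toLocalFactorDatum)

/-- `ClusterOutputs T` (the binder `h31` of the carver's `perL_of_leaves`) from pieces in every good context. -/
theorem clusterOutputs_of_pieces {U : Universe} (T : U.ThetaModel)
    (h : ∀ {L : CMField} {ι₁ : L →+* ℂ} (V : HermSpace3 L ι₁) (c : SeesawCtx L), T.GoodCtx ι₁ c →
      Nonempty (ClusterPieces T V c Pl)) :
    ClusterOutputs T := by
  intro L ι₁ V c hc
  obtain ⟨p⟩ := h V c hc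
  exact ⟨Pl, ⟨SideOutputs.ofPieces p.P₁ p.P₂ p.B₁₂⟩, ⟨SideOutputs.ofPieces p.P₃ p.P₄ p.B₃₄⟩⟩

end EulerProduct
end PerL34
end HodgeCM

end
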